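import Literature.NumberTheory.Automorphic.ShimuraCurveCartanLevelMapDegree
import Literature.NumberTheory.Automorphic.ShimuraCurveCartanLevelErase
import Mathlib.LinearAlgebra.Matrix.FixedDetMatrices
import Mathlib.GroupTheory.Schreier
import HarnessLib

/-!
# The level groups `Γ = ι(O¹)` of Cartan-level Shimura curves are finitely generated (every `D`),
# and so are the norm-one groups of their cover orders

Topic `NumberTheory/Automorphic`; theorems only (no definition, no named fact, no instance, no
`sorry`). For `X : CartanLevelCurveData D M C` (`ShimuraCurveCartanLevel.lean`: indefinite quaternion
algebra `B/ℚ` of discriminant `D`, real splitting `ι`, Eichler hull `O₀` of level `M`, Cartan order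
`O ⊆ O₀`; `X.Gamma = ι(O¹)`, hull group `Γ₀ = ι(O₀¹) = normOneUnits X.ι X.isEichlerOrder.isOrder`):

* `CartanLevelCurveData.fg_normOneUnits_hull` — **the hull group `ι(O₀¹)` is finitely generated**:
  for `D > 1` it is cocompact and properly discontinuous on `ℍ`
  (`ShimuraCurveData.exists_forall_exists_smul_mem_closedBall`, `properlyDiscontinuousSMul_Gamma`), and a
  properly discontinuous group with a compact set meeting every orbit is generated by the finitely
  many elements moving a compact neighbourhood of that set onto itself (Shimura Prop. 8.6, proof;
  `ℍ` connected); for `D = 1` it is `h Γ₀(M) h⁻¹` (the split dictionary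
  `ShimuraCurveData.conjAct_inv_smul_Gamma_eq_of_conj`), and `Γ₀(M)` has finite index in the finitely
  generated `SL(2, ℤ) = ⟨S, T⟩` (Mathlib `SpecialLinearGroup.SL2Z_generators`; also the tree's
  `Literature.Geometry.Kaehler.ComplexTorus.QuaternionType.groupFG_SL2Z` ∕ `subgroupFG_of_isArithmetic`
  for Bergeron's `Γ_{a,b}`) by Schreier's lemma (Mathlib `Subgroup.fg_of_index_ne_zero`).
* `CartanLevelCurveData.finiteIndex_gamma_subgroupOf_hull` — `Γ` has finite index in `Γ₀` (finitely
  many left cosets: `exists_finset_leftCosets`, `ShimuraCurveCartanLevelMapDegree.lean`).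
* `CartanLevelCurveData.fg_Gamma` — **`Γ = ι(O¹)` is finitely generated for EVERY Cartan datum**
  (Schreier again), in particular (`fg_normOneUnits_eraseOrder`, through `X.eraseLevel q` of
  `ShimuraCurveCartanLevelErase.lean`) the norm-one group `ι(O₀'¹)` of the cover order
  `X.O ⊔ (∏_{C∖q} p) • X.O₀` — the group of the BSD cell's full-level-`q` cover (crux
  `CartanOnePlaceDegreeLawAtThree`, named fact (SIGᶜ) `parabolicCochain_free_and_modLift`, whose clause
  (i) «`Hom_par(Γ', ℤ)` has a finite `ℤ`-basis» follows from finite generation).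

Siegel's theorem «every Fuchsian group of the first kind has a finite number of generators»
(Iwaniec Prop. 2.3; Shimura Prop. 8.6 / §1.5) for the arithmetic groups of the tree, by the
cocompact argument at `D > 1` and by reduction to `SL(2, ℤ) = ⟨S, T⟩` at `D = 1`. Filed by the BSD
cell `bsd-stepL` (seat `defn-ty1` g44). Nothing arithmetic is asserted; BSD is proved for no curve.

## References

* G. Shimura, *Introduction to the arithmetic theory of automorphic functions* (1971), Prop. 8.6
  (proof: "The group `Γ` has a finite set of generators"), Prop. 1.31, §1.5.
  [cite: ShimuraIATAF1971, Prop. 8.6 (proof) and Prop. 1.31]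
* H. Iwaniec, *Spectral methods of automorphic forms* (2002), Ch. 2 Prop. 2.3.
  [cite: Iwaniec2002, Ch. 2 Prop. 2.3]
* M.-F. Vignéras, *Arithmétique des algèbres de quaternions*, LNM 800 (1980), Ch. IV §1 Thm. 1.1.
  [cite: VignerasLNM800, Ch. IV §1 Thm. 1.1]
-/

noncomputable section

open UpperHalfPlane
open scoped Pointwise MatrixGroups

namespace Literature.NumberTheory.Automorphic

/-! ### 1. `SL(2, ℤ)` and finite-index subgroups; cocompact groups on `ℍ` -/

/-- **A cocompact properly discontinuous group on `ℍ` is finitely generated** (Shimura 1971,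
Prop. 8.6, proof; Siegel). If `Γ ≤ GL(2, ℝ)` acts properly discontinuously on `ℍ` and a compact `K`
meets every orbit, then `Γ` is generated by the finitely many `γ` with `γ K' ∩ K' ≠ ∅`, `K' ⊇ K` a
compact ball: the union of the translates of an open ball `V`, `K ⊆ V ⊆ K'`, by the subgroup they
generate and the union of the remaining translates are disjoint open sets covering the connected
space `ℍ`. (VERBATIM the argument of `group_fg_of_isCompact_of_forall_exists_smul_mem` of
`ShimuraCurvePeriodsHeckeIntegralityProofs.lean`, kept private here to avoid that module's heavy
import chain.) [cite: ShimuraIATAF1971, Prop. 8.6 (proof)] -/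
private theorem group_fg_of_isCompact_of_forall_exists_smul_mem' {Γ : Subgroup (GL (Fin 2) ℝ)}
    [ProperlyDiscontinuousSMul Γ ℍ] {K : Set ℍ} (hK : IsCompact K)
    (hcov : ∀ τ : ℍ, ∃ γ ∈ Γ, γ • τ ∈ K) : Group.FG Γ := by
  classical
  obtain ⟨R, hR0, hR⟩ := hK.isBounded.subset_closedBall_lt 0 UpperHalfPlane.I
  set V : Set ℍ := Metric.ball UpperHalfPlane.I (R + 1) with hV
  set K' : Set ℍ := Metric.closedBall UpperHalfPlane.I (R + 1) with hK'def
  have hK' : IsCompact K' := isCompact_closedBall _ _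
  have hVK' : V ⊆ K' := Metric.ball_subset_closedBall
  have hKV : K ⊆ V := hR.trans (Metric.closedBall_subset_ball (by linarith))
  have hVopen : IsOpen V := Metric.isOpen_ball
  have hIV : UpperHalfPlane.I ∈ V := Metric.mem_ball_self (by linarith)
  -- the finite generating set
  set S : Set Γ := {γ : Γ | ((fun x : ℍ => γ • x) '' K' ∩ K').Nonempty} with hSdef
  have hSfin : S.Finite := ProperlyDiscontinuousSMul.finite_disjoint_inter_image hK' hK'
  refine Group.fg_iff.mpr ⟨S, ?_, hSfin⟩
  set H : Subgroup Γ := Subgroup.closure S with hHdef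
  -- two translates of `V` by `δ₁ ∈ H` and `δ₂` meet only if `δ₂ ∈ H`
  have key : ∀ δ₁ δ₂ : Γ, δ₁ ∈ H →
      (((δ₁ : GL (Fin 2) ℝ) • V) ∩ ((δ₂ : GL (Fin 2) ℝ) • V)).Nonempty → δ₂ ∈ H := by
    rintro δ₁ δ₂ h₁ ⟨x, hx₁, hx₂⟩
    obtain ⟨v₁, hv₁, rfl⟩ := Set.mem_smul_set.mp hx₁
    obtain ⟨v₂, hv₂, he⟩ := Set.mem_smul_set.mp hx₂
    have hmem : δ₁⁻¹ * δ₂ ∈ S := by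
      refine ⟨v₁, ⟨v₂, hVK' hv₂, ?_⟩, hVK' hv₁⟩
      show ((δ₁⁻¹ * δ₂ : Γ) : GL (Fin 2) ℝ) • v₂ = v₁
      rw [Subgroup.coe_mul, Subgroup.coe_inv, mul_smul, he, inv_smul_smul]
    have : δ₁ * (δ₁⁻¹ * δ₂) ∈ H := H.mul_mem h₁ (Subgroup.subset_closure hmem)
    simpa using this
  -- every point lies in some translate of `V`
  have hcovV : ∀ τ : ℍ, ∃ δ : Γ, τ ∈ (δ : GL (Fin 2) ℝ) • V := by
    intro τ
    obtain ⟨g, hg, hgτ⟩ := hcov τ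
    refine ⟨⟨g, hg⟩⁻¹, Set.mem_smul_set.mpr ⟨g • τ, hKV hgτ, ?_⟩⟩
    rw [Subgroup.coe_inv, Subgroup.coe_mk, inv_smul_smul]
  -- the two open sets
  set U₁ : Set ℍ := ⋃ δ ∈ {δ : Γ | δ ∈ H}, (δ : GL (Fin 2) ℝ) • V with hU₁
  set U₂ : Set ℍ := ⋃ δ ∈ {δ : Γ | δ ∉ H}, (δ : GL (Fin 2) ℝ) • V with hU₂
  have hU₁o : IsOpen U₁ := isOpen_biUnion fun δ _ => hVopen.smul _
  have hU₂o : IsOpen U₂ := isOpen_biUnion fun δ _ => hVopen.smul _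
  have hcover : (Set.univ : Set ℍ) ⊆ U₁ ∪ U₂ := by
    intro τ _
    obtain ⟨δ, hδ⟩ := hcovV τ
    by_cases h : δ ∈ H
    · exact Or.inl (Set.mem_biUnion (show δ ∈ {δ : Γ | δ ∈ H} from h) hδ)
    · exact Or.inr (Set.mem_biUnion (show δ ∈ {δ : Γ | δ ∉ H} from h) hδ)
  have hdisj : (Set.univ : Set ℍ) ∩ (U₁ ∩ U₂) = ∅ := by
    rw [Set.univ_inter, Set.eq_empty_iff_forall_notMem]
    rintro x ⟨hx₁, hx₂⟩
    simp only [hU₁, hU₂, Set.mem_iUnion, Set.mem_setOf_eq, exists_prop] at hx₁ hx₂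
    obtain ⟨δ₁, hδ₁, hxδ₁⟩ := hx₁
    obtain ⟨δ₂, hδ₂, hxδ₂⟩ := hx₂
    exact hδ₂ (key δ₁ δ₂ hδ₁ ⟨x, hxδ₁, hxδ₂⟩)
  have h1V : UpperHalfPlane.I ∈ ((1 : Γ) : GL (Fin 2) ℝ) • V := by
    rw [Subgroup.coe_one, one_smul]; exact hIV
  rcases (isPreconnected_iff_subset_of_disjoint.mp isPreconnected_univ) U₁ U₂ hU₁o hU₂o hcover
    hdisj with hall | hall
  · -- `ℍ = U₁`: every `γ` is in `H`
    rw [eq_top_iff]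
    intro γ _
    have hγI : (γ : GL (Fin 2) ℝ) • UpperHalfPlane.I ∈ U₁ := hall (Set.mem_univ _)
    simp only [hU₁, Set.mem_iUnion, Set.mem_setOf_eq, exists_prop] at hγI
    obtain ⟨δ, hδ, hγδ⟩ := hγI
    exact key δ γ hδ ⟨_, hγδ, Set.smul_mem_smul_set hIV⟩
  · -- `ℍ = U₂` is absurd: `I ∈ 1 • V` with `1 ∈ H`
    exfalso
    have hI : UpperHalfPlane.I ∈ U₂ := hall (Set.mem_univ _)
    simp only [hU₂, Set.mem_iUnion, Set.mem_setOf_eq, exists_prop] at hI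
    obtain ⟨δ, hδ, hIδ⟩ := hI
    exact hδ (key 1 δ H.one_mem ⟨_, h1V, hIδ⟩)

/-- The image of a finitely generated subgroup under a group homomorphism is finitely generated.
[cite: ShimuraIATAF1971, §1.5] -/
private theorem fg_map_of_fg {G G' : Type*} [Group G] [Group G'] (f : G →* G') (K : Subgroup G)
    [hK : Group.FG K] : Group.FG (K.map f) :=
  Group.fg_of_surjective (f.subgroupMap_surjective K)

namespace CartanLevelCurveData

variable {D M : ℕ} {C : Finset ℕ} (X : CartanLevelCurveData D M C)

/-! ### 2. The hull group `ι(O₀¹)` is finitely generated -/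

/-- **The hull group `Γ₀ = ι(O₀¹)` of a Cartan datum is finitely generated** (every `D`): for
`D > 1` by cocompactness and proper discontinuity (Shimura Prop. 8.6), for `D = 1` because
`Γ₀ = h Γ₀(M) h⁻¹` with `Γ₀(M)` of finite index in `SL(2, ℤ) = ⟨S, T⟩` (Schreier).
[cite: ShimuraIATAF1971, Prop. 8.6 (proof) and Prop. 1.31] [cite: VignerasLNM800, Ch. IV §1 Thm. 1.1] -/
theorem fg_normOneUnits_hull : Group.FG (normOneUnits X.ι X.isEichlerOrder.isOrder) := by
  classical
  obtain ⟨fd₀, h₀⟩ := X.exists_isHypFundamentalDomain_hull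
  set X₀ : ShimuraCurveData D M := X.toShimuraCurveData fd₀ h₀ with hX₀
  change Group.FG X₀.Gamma
  have hD0 : D ≠ 0 := fun h => by simpa [h] using X.squarefree
  rcases Nat.lt_or_ge 1 D with hD | hD
  · haveI := X₀.properlyDiscontinuousSMul_Gamma
    obtain ⟨ρ, hρ⟩ := X₀.exists_forall_exists_smul_mem_closedBall hD
    exact group_fg_of_isCompact_of_forall_exists_smul_mem' (isCompact_closedBall _ _) hρ
  · obtain rfl : D = 1 := le_antisymm hD (Nat.one_le_iff_ne_zero.mpr hD0)
    obtain ⟨hMpos, h, -, H⟩ := X₀.exists_conj_of_discr_one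
    haveI : NeZero M := ⟨hMpos.ne'⟩
    have hΓ := X₀.conjAct_inv_smul_Gamma_eq_of_conj H
    -- `X₀.Gamma = h • (Γ₀(M).map mapGL) = (Γ₀(M)).map (conj h ∘ mapGL)`
    have hΓ' : X₀.Gamma = ConjAct.toConjAct h • (CongruenceSubgroup.Gamma0 M).map
        (Matrix.SpecialLinearGroup.mapGL ℝ : SL(2, ℤ) →* GL (Fin 2) ℝ) := by
      rw [← hΓ, smul_smul, ← map_mul, mul_inv_cancel, map_one, one_smul]
    rw [hΓ', Subgroup.pointwise_smul_def, Subgroup.map_map]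
    -- `SL(2, ℤ) = ⟨S, T⟩` is finitely generated (Mathlib `SpecialLinearGroup.SL2Z_generators`; the tree's
    -- `Literature.Geometry.Kaehler.ComplexTorus.QuaternionType.groupFG_SL2Z` is the same statement)
    haveI : Group.FG SL(2, ℤ) := by
      refine ⟨⟨{ModularGroup.S, ModularGroup.T}, ?_⟩⟩
      rw [Finset.coe_insert, Finset.coe_singleton]
      exact SpecialLinearGroup.SL2Z_generators
    haveI : Group.FG (CongruenceSubgroup.Gamma0 M) := Subgroup.fg_of_index_ne_zero _
    exact fg_map_of_fg _ _

/-! ### 3. `Γ` has finite index in the hull group, hence is finitely generated -/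

/-- **`Γ = ι(O¹)` has finite index in the hull group `ι(O₀¹)`**: finitely many left cosets
(`exists_finset_leftCosets`). [cite: VignerasLNM800, Ch. IV §1 Thm. 1.1] [cite: ShimuraIATAF1971, Prop. 1.31] -/
theorem finiteIndex_gamma_subgroupOf_hull :
    (X.Gamma.subgroupOf (normOneUnits X.ι X.isEichlerOrder.isOrder)).FiniteIndex := by
  classical
  obtain ⟨T, hT, hcos⟩ := X.exists_finset_leftCosets
  set Γ₀ := normOneUnits X.ι X.isEichlerOrder.isOrder with hΓ₀
  haveI : Finite (Γ₀ ⧸ X.Gamma.subgroupOf Γ₀) := by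
    refine Finite.of_surjective
      (fun t : {t // t ∈ T} => (QuotientGroup.mk ⟨t.1, hT t.1 t.2⟩ : Γ₀ ⧸ X.Gamma.subgroupOf Γ₀)) ?_
    intro c
    induction c using QuotientGroup.induction_on with
    | H γ =>
      obtain ⟨t, ht, htγ⟩ := hcos γ γ.2
      refine ⟨⟨t, ht⟩, ?_⟩
      rw [QuotientGroup.eq, Subgroup.mem_subgroupOf]
      simpa using htγ
  exact Subgroup.finiteIndex_of_finite_quotient

/-- **`Γ = ι(O¹)` is finitely generated for every Cartan datum** (any `D`, any `C`): a finite-index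
subgroup of the finitely generated hull group (Schreier). Siegel's theorem for the arithmetic
Fuchsian groups `Γ₀^D(M) ∩ Γ_ns(∏ C)` of the tree. [cite: ShimuraIATAF1971, Prop. 8.6 (proof) and Prop. 1.31]
[cite: Iwaniec2002, Ch. 2 Prop. 2.3] -/
theorem fg_Gamma : Group.FG X.Gamma := by
  haveI := X.fg_normOneUnits_hull
  haveI := X.finiteIndex_gamma_subgroupOf_hull
  haveI : Group.FG (X.Gamma.subgroupOf (normOneUnits X.ι X.isEichlerOrder.isOrder)) :=
    Subgroup.fg_of_index_ne_zero _
  exact Group.fg_of_surjective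
    (f := (Subgroup.subgroupOfEquivOfLe X.gamma_le_normOneUnits_hull).toMonoidHom)
    (Subgroup.subgroupOfEquivOfLe X.gamma_le_normOneUnits_hull).surjective

/-- **The norm-one group of the cover order `X.O ⊔ (∏_{C∖q} p) • X.O₀` is finitely generated** — it
is the level group of the Cartan datum `X.eraseLevel q` (for ANY proof `hO'` that the cover order is
an order; the binder of `parabolicCochain_free_and_modLift` ∕ `jacquetLanglands_cartanCover_newform`).
[cite: ShimuraIATAF1971, Prop. 8.6 (proof)] [cite: Iwaniec2002, Ch. 2 Prop. 2.3] -/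
theorem fg_normOneUnits_eraseOrder (q : ℕ)
    (hO' : Brandt.IsOrder X.B (X.O ⊔ X.O₀.map ((((∏ p ∈ C.erase q, p : ℕ) : ℤ)) • LinearMap.id))) :
    Group.FG (normOneUnits X.ι hO') :=
  (X.eraseLevel q).fg_Gamma

end CartanLevelCurveData

/-- **The norm-one group `ι(O¹)` of EVERY order between a Cartan order and its hull that is of the
form "Cartan order of some level" is finitely generated** — recorded for the bare group
`normOneUnits ι hO` of an arbitrary Cartan datum's own order (`X.Gamma` by definition).
[cite: ShimuraIATAF1971, Prop. 8.6 (proof)] -/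
theorem fg_normOneUnits_of_cartanLevelCurveData {D M : ℕ} {C : Finset ℕ}
    (X : CartanLevelCurveData D M C) : Group.FG (normOneUnits X.ι X.isOrder) :=
  X.fg_Gamma

end Literature.NumberTheory.Automorphic

end
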